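/-
Copyright (c) 2026 the pub-hodgecm-mathlib formalisation cell (harness21).  Seat hodgecm-mathlib-F0P3a-p01 (g38), explicit-unit SUPPORTS-ONLY on
h413 = `stmt-HodgeConjecture-24833` (Track A «(D-RAM) FOUR-FRAME», heir LEAD rules 57 ∕ 69: the organ of the dyadic leaf is paid through a `Theorems` twin of the
tier-0 composition `DyRamCore_of`, never by a `Lines → Lines` import).  2026-09-04.
-/
import Summits.HodgeConjecture.HodgeConjecture.Theorems.F0P3cDyRamFourFrameSocketDefs            -- ★ p854576 DEFS №2a `RankTransferWild`, `AnchorRowsWild`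
import Summits.HodgeConjecture.HodgeConjecture.Theorems.F0P3cDyRamFourFramePieces                -- DEFS №3 `gselStar`, `mstarFn`, `PiecePropsWild`, `RankTableWild`, `PieceRowsWild`
import Summits.HodgeConjecture.HodgeConjecture.Theorems.F0P3cDyRamAnchorRowsWildOfSlices        -- #15 `anchorRowsWild_of_slices` (F0P3a-p01 v1.5 §6)
import Summits.HodgeConjecture.HodgeConjecture.Theorems.F0P3cDyRamRankTransferWildOfAnchorRows  -- #6 `rankTransferWild_of_anchorRows` (GATE 1a-1 §5)
import Summits.HodgeConjecture.HodgeConjecture.Theorems.F0P3cDyRamCoreOfRankTransferWild        -- #14 `dyRamCore_of_rankTransferWild` (cert v1.1)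
import Summits.HodgeConjecture.HodgeConjecture.Theorems.F0P3cDyRamPiecePropsGselStar           -- ★ «PAYER-T0-PP» (LH4-p12 g0): pays `stub_pieceProps` BY NAME ((R-15) ★-twin of the U4 export)
import Summits.HodgeConjecture.HodgeConjecture.Theorems.F0P3cDyRamRankTableWildGselStar          -- ★ p855060 «PAYER-T0-RT» (LH4-p04 g0): pays `stub_rankTableWild` BY NAME ((R-15) ★-twin of the U4 export `rankTableWild_gselStar`)
import Summits.HodgeConjecture.HodgeConjecture.Theorems.F0P3cDyRamPieceRowsWildUnit0OfExports      -- ★ p857318 (LH4-p11 (g4); (R-24)(a)): `pieceRowsWild_gselStar_zero_of (hU3) (hDH) (hDG) : PieceRowsWild gselStar 0` — the ED. 4 pay line's head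
import Summits.HodgeConjecture.HodgeConjecture.Theorems.F0P3cDyRamFourFrameLawsWildOfRecordR2      -- ★ p857343 (LH4-p05 (g4); (R-24)(b)): `fourFrameLawsWildOfRecordR2_omegaR` = the CLOSED ★ twin of U3's export (U3 ED. 15 e5c2ce7e, 0 sorries)
import Summits.HodgeConjecture.HodgeConjecture.Theorems.F0P3cDyRamHSideAnchorRowsRUnit0OfRecord   -- ★ p858613 (LH4-p10 (g4); (R-24)(c)): `hSideAnchorRowsR_unit0_ofRecord` = the CLOSED ★ twin of U2H's export (U2H ED. 16 f0aa32f03e472ead, 0 sorries; :418 ← ★ p858565)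
import Summits.HodgeConjecture.HodgeConjecture.Theorems.F0P3cDyRamAnchorCountDictionaryZero       -- ★ (unit U2G, CLOSED): `anchorCountDictionary_zero : AnchorCountDictionary 0`
import Summits.HodgeConjecture.HodgeConjecture.Theorems.F0P3cDyRamTierZeroRowsTwoThreeOfLevels    -- ★ p859234 (LH4-p06 (g6)) THE JUNCTIONS `pieceRowsWild_gselStar_two_of_fencedLaws_of_hsides`, `…three_of_fencedLaw_of_hside` (ED. 5)
import Summits.HodgeConjecture.HodgeConjecture.Theorems.F0P3cDyRamOmegaRDefs                        -- ★ `omegaR` (the Ω schedule of record, (R-28)); brings ★ №1-R `shiftR`, ★ №1 `DyadicFence`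
import Summits.HodgeConjecture.HodgeConjecture.Theorems.F0P3cDyRamStageOneBDefs                    -- ★ p859562 (F0P3a-p01 (g36)) DEFS LEAF №5 «STAGE-1b»: counts, schedules, amplitudes `amplCs`∕`amplLevHi`, law Props, H-side Props
import Summits.HodgeConjecture.HodgeConjecture.Theorems.F0P3cDyRamStageOneBDerivedDefs             -- ★ p859675 (LH4-p05 (g8)) DEFS LEAF №6 «STAGE-1b DERIVED (T₊)»: `amplShift`, `amplTransvPlusDerived`, `n0DerivedOfRecord`, (α′)(β) Props, `TransvPlusLawTarget(Derived)`
import Summits.HodgeConjecture.HodgeConjecture.Theorems.F0P3cDyRamHSideTransvPlusGuarded       -- ★ (LH4-p14 (g6)) THE GUARDED JUNCTION `pieceRowsWild_gselStar_one_of_fencedLaw_of_rows` (form (A′): root guards `v(a−1) < v 2`, `v(b−1) < v 2` in the hA letter; p14 11:37:57Z flag, r01 BOX MT, REF5 R5-282)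
import Summits.HodgeConjecture.HodgeConjecture.Theorems.F0P3cDyRamTransvPlusLawOfCleanLevels            -- ★ (LH4-p05 (g8)) THE REDUCTION BRICK `transvPlusLawTargetDerived_of` ((L-T+) derived ⟸ two clean-level laws + (α′) + (β))
import Summits.HodgeConjecture.HodgeConjecture.Theorems.F0P3cDyRamLabelPlusCleanOfRecord               -- ★ (LH4-p13 (g8)) (α′) PAID BY NAME `dyadicFence_labelPlusCleanLawAt_derived_ofRecord` (T19-40 (R-30)(2))
import Summits.HodgeConjecture.HodgeConjecture.Theorems.F0P3cDyRamSqKappaSignLawOfBoxSum             -- ★ (LH4-p12 (g7)) (L-sq) PART 5 HEAD `dyadicFence_sqKappaSignLawAtS2_ofRecord` — pays `stub_law_sq` BY NAME (ED. 7; over ★ p860095 `SqLabelledBoxSum_holds` (LH4-p10 (g6)), ★ p860013, ★ p860059∕p860125∕p860129)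
import Summits.HodgeConjecture.HodgeConjecture.Theorems.F0P3cDyRamLevKappaSignLawsOfRecord -- ★ p860456 + ED. 2 (primed heads): the four level κ-sign laws of record (LH4-p12 (g7)); chain ★ LevLabelledBoxSum (F0P3a-p01 (g36)) ∘ ★ p860523 ∘ ★ p860250
import Summits.HodgeConjecture.HodgeConjecture.Theorems.F0P3cDyRamHSideStubsOfRecord                -- ★ p861872 (LH4-p06 (g7)) ED. 9: `levels_typeTwo_censusLaw'` = THE (LAW) END HYPOTHESIS-FREE over LH4-p07 (g9)'s RamM socket ★ p861756 `levelsCensusC`, `hEnd_ofRecord` (★ D2's section hypothesis, closed), the T₊ junction `hSideRows_transvPlus_ofRecord'`; brings ★ D2 `F0P3cDyRamHSideStubsOfLevelsCensusLaw` (p860744) transitively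
import HarnessLib

/-!
# H413 · Track A «(D-RAM) FOUR-FRAME» — THE HYPOTHESIS-FORM `Theorems` TWIN OF THE TIER-0 COMPOSITION `DyRamCore_of`:
# the organ text of `stub_DyRamCore` from EXACTLY the two open STAGE-1b letters (β) `stub_law_cleanSgn` and (β₂) `stub_law_cleanSgn₂`

Crux H413 = `stmt-HodgeConjecture-24833`; route `HCCMUnconditional`; cell `pub/hodgecm-mathlib`.  Tier 0 of the «(D-RAM) FOUR-FRAME» skeleton is the line
`Cruxes/H413/Lines/F0_P3c_DyRamFourFrame.lean` ED. 9 (tree sha16 `15ff489c14e525b6`): nineteen declarations, seventeen of them theorem lines over ★ `Theorems`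
heads, two open stubs — (β) `stub_law_cleanSgn` (the clean sign census is frame-constant, `DyadicFence (CleanSgnFrameConstLawAt n0DerivedOfRecord mcOfRecord …)`)
and (β₂) `stub_law_cleanSgn₂` (the type-(2) clean-shell label balance, difference form) — and the trio-closed composition `DyRamCore_of` of the six piece
statements to the organ text of `stub_DyRamCore` (leaf `Cruxes/H413/Lines/F0_P3c_DyadicPaydown.lean` ED. 4 :147–:170).

WHAT THIS FILE PROVES (no open goal, axioms = the trio; THEOREMS ONLY — no `def`, no `instance`, no notation, no named-fact hypothesis; imports = the tier-0
line's own ★ `Theorems` imports + `HarnessLib`, NO `Cruxes/**` module):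
* `pieceRowsWild_gselStar_three_ofRecord : PieceRowsWild gselStar 3` — the three population rows of the regular-profile piece `f_reg`, CLOSED (★ junction
  `pieceRowsWild_gselStar_three_of_fencedLaw_of_hside` over ★ `pieceRowsWild_gselStar_zero_of …` (row of `1_K`, ED. 4 pay line), ★ (L-sq)
  `dyadicFence_sqKappaSignLawAtS2_ofRecord`, ★ (H-sq) `hSideSqTripleS_ofRecord hEnd_ofRecord`) — the tier-0 theorem line `stub_rows_regular` as a bare ★ constant;
* `pieceRowsWild_gselStar_one_of_letters (hβ) (hβ₂) : PieceRowsWild gselStar 1` — the rows of `f_{T+}` from the two letters (★ guarded junction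
  `pieceRowsWild_gselStar_one_of_fencedLaw_of_rows` ∘ ★ brick `transvPlusLawTargetDerived_of` over ★ (L-T+-lo∕hi) `dyadicFence_levKappaSignLawAtS2_cleanLo∕cleanHi_ofRecord'`,
  ★ (α′) `dyadicFence_labelPlusCleanLawAt_derived_ofRecord`, `hβ`; H-side ★ D3′ `hSideRows_transvPlus_ofRecord' hβ₂`) — tier-0 `stub_rows_transvPlus` with its two open letters
  as hypotheses;
* `pieceRowsWild_gselStar_two_of_letters (hβ) (hβ₂) : PieceRowsWild gselStar 2` — the rows of `f_{T−}` (★ junction `…two_of_fencedLaws_of_hsides` over the previous row and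
  the four ★ level laws ∕ H-sides of record);
* `dyRamCore_of_pieceRowsWild_one (h1 : PieceRowsWild gselStar 1) : ‹organ text›` — the organ from the ONE open row (rows 0, 2-from-1, 3, piece props ★ p854876, rank
  table ★ p855060, then ★ #15 `anchorRowsWild_of_slices` → ★ #6 `rankTransferWild_of_anchorRows` → ★ #14 `dyRamCore_of_rankTransferWild` at `mstarFn`, `gselStar`);
* `dyRamCore_of_cleanSgn_of_cleanSgn₂ (hβ) (hβ₂) : ‹organ text›` — **the hypothesis-form twin of `DyRamCore_of`**: the organ text of `stub_DyRamCore` VERBATIM (type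
  digit of record 4239658620) from EXACTLY the two open letters, whose types are the tier-0 stub statements :211–212 and :231–260 VERBATIM.
USE (rule 69, «hypothesis-form twin first, then the bare-constant pay line»): the minute (β) and (β₂) are ★ `Theorems` constants — (β) `…CleanSgnOfRecord.cleanSgn_ofRecord`
(β chair LH4-p05 lineage, pay line `…StageBBoxForm.…_of_box (hbox_of_oddBoxSum oddLabelledBoxSum hP3G1_ofRecord hP3G2_ofRecord hP2G3_ofRecord (hRest_of_heads hK hW hB hZ))`),
(β₂) `…CleanSgnDiffTypeTwoOfRecord.cleanSgnDiffTypeTwo_ofRecord` (LH4-p04 lineage, `hbeta2_of_literals ∘ … ∘ hbeta2Cells_of_types A B C`) — the CLOSED twin is the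
two-token application `dyRamCore_ofRecord := dyRamCore_of_cleanSgn_of_cleanSgn₂ cleanSgn_ofRecord cleanSgnDiffTypeTwo_ofRecord` in its own three-line file, and the
dyadic leaf's ED. 5 pays `stub_DyRamCore := ‹that constant›` importing `Theorems` only (no tier-0 import; tier-0 ED. 10 and LHD ED. 5 become independent editions).
If only one letter lands first, `dyRamCore_of_pieceRowsWild_one` ∕ the `_of_letters` rows give the one-letter intermediate without re-typing anything.

HONEST LABEL: count-neutral — this file closes NOTHING by itself (its two hypotheses ARE the two open tier-0 letters (β), (β₂); no row newly PAID; books, registries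
and the organ `stub_DyRamCore` untouched); h413 OPEN (verdict of record PRINT ∕ XL); HC_CM is proved only modulo the 7 printed citations (2 remaining named inputs:
hLiu418 = `stmt-HodgeConjecture-24832`, h413 = `stmt-HodgeConjecture-24833`) until rung 0 closes.

## References
* [Rogawski1990] J. D. Rogawski, *Automorphic Representations of Unitary Groups in Three Variables*, Ann. of Math. Stud. 123 (1990): Prop. 4.9.1 (a) p. 55, §4.9
  pp. 55–57, §8.1 Props. 8.1.1–8.1.2 pp. 112–114, §12.2.
* [LanglandsShelstad1989] R. P. Langlands, D. Shelstad, *Orbital integrals on forms of SL(3), II*, Canad. J. Math. 41 (1989) 480–507: Theorem (end of §2, p. 484).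
* [LanglandsShelstad1987] R. P. Langlands, D. Shelstad, *On the definition of transfer factors*, Math. Ann. 278 (1987), §1–§3.
-/

set_option autoImplicit false
-- the mandated namespace repeats the single-problem summit's segment (`HodgeConjecture.HodgeConjecture`)
set_option linter.dupNamespace false

noncomputable section

namespace Summit.HodgeConjecture.HodgeConjecture.Cruxes.H413.F0P3cDyRamCoreOfLetters

open MeasureTheory Measure NumberField IsDedekindDomain Topology Filter
open Literature.NumberTheory.Automorphic Literature.NumberTheory.Automorphic.UnitaryGroup Literature.NumberTheory.Automorphic.IntegralReduction
open Literature.NumberTheory.Rogawski1990 Literature.NumberTheory.GaloisRepresentations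
open Literature.MeasureTheory.Group (descConj)
open scoped Matrix MatrixGroups Classical ValuativeRel
open Summit.HodgeConjecture.HodgeConjecture.Cruxes.H413.F0P3cDyRamFourFrameSocketDefs
open Summit.HodgeConjecture.HodgeConjecture.Cruxes.H413.F0P3cDyRamFourFramePieces
open Summit.HodgeConjecture.HodgeConjecture.Cruxes.H413.F0P3cDyRamAnchorRowsWildOfSlices
open Summit.HodgeConjecture.HodgeConjecture.Cruxes.H413.F0P3cDyRamRankTransferWildOfAnchorRows
open Summit.HodgeConjecture.HodgeConjecture.Cruxes.H413.F0P3cDyRamCoreOfRankTransferWild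
open scoped WithZero
open Literature.NumberTheory.Automorphic.UnitaryThreeFourFrame
open Summit.HodgeConjecture.HodgeConjecture.Cruxes.H413.F0P3cDyRamFourFrameLawDefs
open Summit.HodgeConjecture.HodgeConjecture.Cruxes.H413.F0P3cDyRamFourFrameLawDefsR
open Summit.HodgeConjecture.HodgeConjecture.Cruxes.H413.F0P3cDyRamFourFrameLawDefsR2
open Summit.HodgeConjecture.HodgeConjecture.Cruxes.H413.F0P3cDyRamOmegaRDefs
open Summit.HodgeConjecture.HodgeConjecture.Cruxes.H413.F0P3cDyRamTierZeroRowsTwoThreeOfLevels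
open Summit.HodgeConjecture.HodgeConjecture.Cruxes.H413.F0P3cDyRamStageOneBDefs
open Summit.HodgeConjecture.HodgeConjecture.Cruxes.H413.F0P3cDyRamStageOneBDerivedDefs
open Summit.HodgeConjecture.HodgeConjecture.Cruxes.H413.F0P3cDyRamHSideTransvPlusGuarded
open Summit.HodgeConjecture.HodgeConjecture.Cruxes.H413.F0P3cDyRamTransvPlusLawOfCleanLevels
open Literature.NumberTheory.Automorphic.UnitaryLatticeTree Literature.NumberTheory.Automorphic.HermitianLattice    -- (form A only)
open Summit.HodgeConjecture.HodgeConjecture.Cruxes.H413.F0P3cDyRamFourFrameHSideDefs    -- (form A only)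
open Summit.HodgeConjecture.HodgeConjecture.Cruxes.H413.F0P3cDyRamFourFrameHSideDefsR    -- (form A only)
open Summit.HodgeConjecture.HodgeConjecture.Cruxes.H413.F0P3cDyRamFourFrameHFamilyDefs    -- (form A only)
open Summit.HodgeConjecture.HodgeConjecture.Cruxes.H413.F0P3cDyRamFourFrameCensusDefs    -- (form A only)

/-! ## §1  the two CLOSED rows as bare ★ constants -/

/-- Row of the type-0 anchor `1_K` (tier-0 `stub_rows_unit0`, ED. 4 pay line as a ★ `Theorems` constant): ★ p857318 `pieceRowsWild_gselStar_zero_of` over ★ p857343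
(U3 closed twin `fourFrameLawsWildOfRecordR2_omegaR`), ★ p858613 (U2H closed twin `hSideAnchorRowsR_unit0_ofRecord`), ★ `anchorCountDictionary_zero` (U2G). -/
theorem pieceRowsWild_gselStar_zero_ofRecord : PieceRowsWild gselStar 0 :=
  Summit.HodgeConjecture.HodgeConjecture.Cruxes.H413.F0P3cDyRamPieceRowsWildUnit0OfExports.pieceRowsWild_gselStar_zero_of
    Summit.HodgeConjecture.HodgeConjecture.Cruxes.H413.F0P3cDyRamFourFrameLawsWildOfRecordR2.fourFrameLawsWildOfRecordR2_omegaR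
    Summit.HodgeConjecture.HodgeConjecture.Cruxes.H413.F0P3cDyRamHSideAnchorRowsRUnit0OfRecord.hSideAnchorRowsR_unit0_ofRecord
    Summit.HodgeConjecture.HodgeConjecture.Cruxes.H413.F0P3cDyRamAnchorCountDictionaryZero.anchorCountDictionary_zero

/-- Row of the regular-profile piece `f_reg` (tier-0 `stub_rows_regular`), CLOSED: ★ p859234 junction `pieceRowsWild_gselStar_three_of_fencedLaw_of_hside` at the tokens of
record (`shiftR`, `omegaR`, `depthOfRecord`, `amplCs`) over the row of `1_K`, ★ (L-sq) `dyadicFence_sqKappaSignLawAtS2_ofRecord` (LH4-p12 (g7), ED. 7) and ★ (H-sq)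
`hSideSqTripleS_ofRecord hEnd_ofRecord` (★ D2 p860744 head at ★ p861872 `hEnd_ofRecord`, ED. 9). -/
theorem pieceRowsWild_gselStar_three_ofRecord : PieceRowsWild gselStar 3 :=
  F0P3cDyRamTierZeroRowsTwoThreeOfLevels.pieceRowsWild_gselStar_three_of_fencedLaw_of_hside shiftR omegaR depthOfRecord amplCs
    pieceRowsWild_gselStar_zero_ofRecord
    F0P3cDyRamSqKappaSignLawOfBoxSum.dyadicFence_sqKappaSignLawAtS2_ofRecord
    (F0P3cDyRamHSideStubsOfLevelsCensusLaw.hSideSqTripleS_ofRecord F0P3cDyRamHSideStubsOfRecord.hEnd_ofRecord)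

/-! ## §2  the rows of `f_{T+}` and `f_{T−}` from the two open letters (β), (β₂) -/

set_option maxHeartbeats 800000 in
-- statement-heavy: the (β₂) letter is place-sized
/-- Row of the labeled near-transvection piece `f_{T+}` (tier-0 `stub_rows_transvPlus`, ED. 6 composition) FROM THE TWO OPEN LETTERS: `hβ` = the statement of tier-0
`stub_law_cleanSgn` :211–212 VERBATIM ((β) clean sign census frame-constant), `hβ₂` = the statement of tier-0 `stub_law_cleanSgn₂` :231–260 VERBATIM ((β₂) type-(2)
clean-shell label balance, difference form).  Body = the tier-0 line's: ★ guarded junction `pieceRowsWild_gselStar_one_of_fencedLaw_of_rows` at (`shiftR`, `omegaR`,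
`n0DerivedOfRecord`, `amplTransvPlusDerived`) ∘ ★ brick `transvPlusLawTargetDerived_of n0DerivedOfRecord` over ★ (L-T+-lo) ∕ (L-T+-hi) `dyadicFence_levKappaSignLawAtS2_cleanLo∕cleanHi_ofRecord'`,
★ (α′) `dyadicFence_labelPlusCleanLawAt_derived_ofRecord`, `hβ`; H-side row (H-T+) = ★ D3′ `hSideRows_transvPlus_ofRecord' hβ₂`. -/
theorem pieceRowsWild_gselStar_one_of_letters
    (hβ : ∀ {K : Type} [Field K] [Valued K ℤᵐ⁰] [CompleteSpace K] [Fintype (Valued.ResidueField K)] (σ : K →+* K) (ϖ : K) (d t : ℕ),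
    DyadicFence (K := K) (CleanSgnFrameConstLawAt n0DerivedOfRecord mcOfRecord σ ϖ d t))
    (hβ₂ :
      ∀ (L : Type) [Field L] [NumberField L] [IsCMField L]
        {v : HeightOneSpectrum (𝓞 ↥(maximalRealSubfield L))} (w : UnitaryGroup.PlacesOver L v)
        (hw : IsCMField.complexConj L • w.1 = w.1) (_he : v.asIdeal.ramificationIdx' w.1.asIdeal ≠ 1)
        (_h2 : ¬ IsUnit (2 : Valued.integer (w.1.adicCompletion L)))
        (ϖ : (w.1.adicCompletion L)) (_hϖ : Valued.v ϖ = WithZero.exp (-1 : ℤ)) (d tE : ℕ) (_hD : IsRamifiedQuadraticDatum (galAdicCompletionMap (L := L) (IsCMField.complexConj L) hw) ϖ d tE)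
        [Fintype (Valued.ResidueField (w.1.adicCompletion L))] (δ : (w.1.adicCompletion L)) (_hδ : (galAdicCompletionMap (L := L) (IsCMField.complexConj L) hw) δ = -δ) (_hδ0 : δ ≠ 0)
        (μ : HeckeCharacter L) (_hμu : μ.IsUnitary)
        (_hμω : ∀ x : ideleGroup ↥(maximalRealSubfield L), μ (AdeleRing.ideleBaseChange ↥(maximalRealSubfield L) L x) = quadraticHeckeCharCM L x)
        [MeasurableSpace ((UnitaryGroup.cmDatum L 3 (Matrix.of fun i j : Fin 3 => if i.val + j.val + 1 = 3 then (1 : L) else 0)).Local v)] [BorelSpace ((UnitaryGroup.cmDatum L 3 (Matrix.of fun i j : Fin 3 => if i.val + j.val + 1 = 3 then (1 : L) else 0)).Local v)]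
        [∀ γ : ((UnitaryGroup.cmDatum L 3 (Matrix.of fun i j : Fin 3 => if i.val + j.val + 1 = 3 then (1 : L) else 0)).Local v), MeasurableSpace (((UnitaryGroup.cmDatum L 3 (Matrix.of fun i j : Fin 3 => if i.val + j.val + 1 = 3 then (1 : L) else 0)).Local v) ⧸ Subgroup.centralizer ({γ} : Set ((UnitaryGroup.cmDatum L 3 (Matrix.of fun i j : Fin 3 => if i.val + j.val + 1 = 3 then (1 : L) else 0)).Local v)))]
        [∀ γ : ((UnitaryGroup.cmDatum L 3 (Matrix.of fun i j : Fin 3 => if i.val + j.val + 1 = 3 then (1 : L) else 0)).Local v), BorelSpace (((UnitaryGroup.cmDatum L 3 (Matrix.of fun i j : Fin 3 => if i.val + j.val + 1 = 3 then (1 : L) else 0)).Local v) ⧸ Subgroup.centralizer ({γ} : Set ((UnitaryGroup.cmDatum L 3 (Matrix.of fun i j : Fin 3 => if i.val + j.val + 1 = 3 then (1 : L) else 0)).Local v)))]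
        [MeasurableSpace ((UnitaryGroup.cmDatum L 2 (Matrix.of fun i j : Fin 2 => if i.val + j.val + 1 = 2 then (1 : L) else 0)).Local v × (UnitaryGroup.cmDatum L 1 (Matrix.of fun i j : Fin 1 => if i.val + j.val + 1 = 1 then (1 : L) else 0)).Local v)] [BorelSpace ((UnitaryGroup.cmDatum L 2 (Matrix.of fun i j : Fin 2 => if i.val + j.val + 1 = 2 then (1 : L) else 0)).Local v × (UnitaryGroup.cmDatum L 1 (Matrix.of fun i j : Fin 1 => if i.val + j.val + 1 = 1 then (1 : L) else 0)).Local v)]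
        [∀ a : ((UnitaryGroup.cmDatum L 2 (Matrix.of fun i j : Fin 2 => if i.val + j.val + 1 = 2 then (1 : L) else 0)).Local v × (UnitaryGroup.cmDatum L 1 (Matrix.of fun i j : Fin 1 => if i.val + j.val + 1 = 1 then (1 : L) else 0)).Local v), MeasurableSpace (((UnitaryGroup.cmDatum L 2 (Matrix.of fun i j : Fin 2 => if i.val + j.val + 1 = 2 then (1 : L) else 0)).Local v × (UnitaryGroup.cmDatum L 1 (Matrix.of fun i j : Fin 1 => if i.val + j.val + 1 = 1 then (1 : L) else 0)).Local v) ⧸ Subgroup.centralizer ({a} : Set ((UnitaryGroup.cmDatum L 2 (Matrix.of fun i j : Fin 2 => if i.val + j.val + 1 = 2 then (1 : L) else 0)).Local v × (UnitaryGroup.cmDatum L 1 (Matrix.of fun i j : Fin 1 => if i.val + j.val + 1 = 1 then (1 : L) else 0)).Local v)))]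
        [∀ a : ((UnitaryGroup.cmDatum L 2 (Matrix.of fun i j : Fin 2 => if i.val + j.val + 1 = 2 then (1 : L) else 0)).Local v × (UnitaryGroup.cmDatum L 1 (Matrix.of fun i j : Fin 1 => if i.val + j.val + 1 = 1 then (1 : L) else 0)).Local v), BorelSpace (((UnitaryGroup.cmDatum L 2 (Matrix.of fun i j : Fin 2 => if i.val + j.val + 1 = 2 then (1 : L) else 0)).Local v × (UnitaryGroup.cmDatum L 1 (Matrix.of fun i j : Fin 1 => if i.val + j.val + 1 = 1 then (1 : L) else 0)).Local v) ⧸ Subgroup.centralizer ({a} : Set ((UnitaryGroup.cmDatum L 2 (Matrix.of fun i j : Fin 2 => if i.val + j.val + 1 = 2 then (1 : L) else 0)).Local v × (UnitaryGroup.cmDatum L 1 (Matrix.of fun i j : Fin 1 => if i.val + j.val + 1 = 1 then (1 : L) else 0)).Local v)))]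
        (νH : Measure ((UnitaryGroup.cmDatum L 2 (Matrix.of fun i j : Fin 2 => if i.val + j.val + 1 = 2 then (1 : L) else 0)).Local v × (UnitaryGroup.cmDatum L 1 (Matrix.of fun i j : Fin 1 => if i.val + j.val + 1 = 1 then (1 : L) else 0)).Local v)) [νH.IsHaarMeasure] [νH.IsMulRightInvariant]
        (νG₃ : Measure ((UnitaryGroup.cmDatum L 3 (Matrix.of fun i j : Fin 3 => if i.val + j.val + 1 = 3 then (1 : L) else 0)).Local v)) [νG₃.IsHaarMeasure] [νG₃.IsMulRightInvariant]
        (mH : OrbitalMeasureFamily ((UnitaryGroup.cmDatum L 2 (Matrix.of fun i j : Fin 2 => if i.val + j.val + 1 = 2 then (1 : L) else 0)).Local v × (UnitaryGroup.cmDatum L 1 (Matrix.of fun i j : Fin 1 => if i.val + j.val + 1 = 1 then (1 : L) else 0)).Local v)) (mG₃ : OrbitalMeasureFamily ((UnitaryGroup.cmDatum L 3 (Matrix.of fun i j : Fin 3 => if i.val + j.val + 1 = 3 then (1 : L) else 0)).Local v))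
        (_hmH : mH.IsCanonical (IsLocalGRegular L v) νH) (_hmG : mG₃.IsCanonical (fun γ => IsRegularElt (γ.val : GL (Fin 3) (UnitaryGroup.LocalRing L v))) νG₃),
                  (∃ V ∈ 𝓝 (1 : ((UnitaryGroup.cmDatum L 2 (Matrix.of fun i j : Fin 2 => if i.val + j.val + 1 = 2 then (1 : L) else 0)).Local v × (UnitaryGroup.cmDatum L 1 (Matrix.of fun i j : Fin 1 => if i.val + j.val + 1 = 1 then (1 : L) else 0)).Local v)), ∀ γH ∈ V, IsLocalGRegular L v γH →
      ¬ (∃ x : (w.1.adicCompletion L), (((((γH).1.val : GL (Fin 2) (UnitaryGroup.LocalRing L v)).val.map (Pi.evalRingHom (fun w' : UnitaryGroup.PlacesOver L v => w'.1.adicCompletion L) w))).charpoly).IsRoot x) →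
      ∀ δp δm : ((UnitaryGroup.cmDatum L 3 (Matrix.of fun i j : Fin 3 => if i.val + j.val + 1 = 3 then (1 : L) else 0)).Local v), IsLocalNormPair L (Matrix.of fun i j : Fin 3 => if i.val + j.val + 1 = 3 then (1 : L) else 0) v γH δp → finKappaAt L v (Matrix.of fun i j : Fin 3 => if i.val + j.val + 1 = 3 then (1 : L) else 0) γH δp = 1 → IsLocalNormPair L (Matrix.of fun i j : Fin 3 => if i.val + j.val + 1 = 3 then (1 : L) else 0) v γH δm → finKappaAt L v (Matrix.of fun i j : Fin 3 => if i.val + j.val + 1 = 3 then (1 : L) else 0) γH δm = -1 →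
        (transvPlusFixCount (galAdicCompletionMap (L := L) (IsCMField.complexConj L) hw) ϖ d (d % 2) (mstarOfRecord d) ((localNonsplitEquiv (IsCMField.complexConj L) (Matrix.of fun i j : Fin 3 => if i.val + j.val + 1 = 3 then (1 : L) else 0) (IsCMField.complexConj_ne_one L) w hw δp :
              ↥(unitaryGroupOfForm (galAdicCompletionMap (L := L) (IsCMField.complexConj L) hw) (placeForm (Matrix.of fun i j : Fin 3 => if i.val + j.val + 1 = 3 then (1 : L) else 0) w.1))) : GL (Fin 3) (w.1.adicCompletion L)) : ℤ) -
            (cleanMinusFixCount (galAdicCompletionMap (L := L) (IsCMField.complexConj L) hw) ϖ d (d % 2) (mstarOfRecord d) (mcOfRecord d) ((localNonsplitEquiv (IsCMField.complexConj L) (Matrix.of fun i j : Fin 3 => if i.val + j.val + 1 = 3 then (1 : L) else 0) (IsCMField.complexConj_ne_one L) w hw δp :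
              ↥(unitaryGroupOfForm (galAdicCompletionMap (L := L) (IsCMField.complexConj L) hw) (placeForm (Matrix.of fun i j : Fin 3 => if i.val + j.val + 1 = 3 then (1 : L) else 0) w.1))) : GL (Fin 3) (w.1.adicCompletion L)) : ℤ) =
          (transvPlusFixCount (galAdicCompletionMap (L := L) (IsCMField.complexConj L) hw) ϖ d (d % 2) (mstarOfRecord d) ((localNonsplitEquiv (IsCMField.complexConj L) (Matrix.of fun i j : Fin 3 => if i.val + j.val + 1 = 3 then (1 : L) else 0) (IsCMField.complexConj_ne_one L) w hw δm :
              ↥(unitaryGroupOfForm (galAdicCompletionMap (L := L) (IsCMField.complexConj L) hw) (placeForm (Matrix.of fun i j : Fin 3 => if i.val + j.val + 1 = 3 then (1 : L) else 0) w.1))) : GL (Fin 3) (w.1.adicCompletion L)) : ℤ) -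
            (cleanMinusFixCount (galAdicCompletionMap (L := L) (IsCMField.complexConj L) hw) ϖ d (d % 2) (mstarOfRecord d) (mcOfRecord d) ((localNonsplitEquiv (IsCMField.complexConj L) (Matrix.of fun i j : Fin 3 => if i.val + j.val + 1 = 3 then (1 : L) else 0) (IsCMField.complexConj_ne_one L) w hw δm :
              ↥(unitaryGroupOfForm (galAdicCompletionMap (L := L) (IsCMField.complexConj L) hw) (placeForm (Matrix.of fun i j : Fin 3 => if i.val + j.val + 1 = 3 then (1 : L) else 0) w.1))) : GL (Fin 3) (w.1.adicCompletion L)) : ℤ))) :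
    PieceRowsWild gselStar 1 :=
  F0P3cDyRamHSideTransvPlusGuarded.pieceRowsWild_gselStar_one_of_fencedLaw_of_rows shiftR omegaR n0DerivedOfRecord amplTransvPlusDerived
    (F0P3cDyRamTransvPlusLawOfCleanLevels.transvPlusLawTargetDerived_of n0DerivedOfRecord
      F0P3cDyRamLevKappaSignLawsOfRecord.dyadicFence_levKappaSignLawAtS2_cleanLo_ofRecord'
      F0P3cDyRamLevKappaSignLawsOfRecord.dyadicFence_levKappaSignLawAtS2_cleanHi_ofRecord'
      F0P3cDyRamLabelPlusCleanOfRecord.dyadicFence_labelPlusCleanLawAt_derived_ofRecord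
      hβ)
    (F0P3cDyRamHSideStubsOfRecord.hSideRows_transvPlus_ofRecord' hβ₂)

/-- Row of the class-`−` near-transvection piece `f_{T−}` (tier-0 `stub_rows_transvMinus`, ED. 5 composition) from a row of `f_{T+}`: ★ p859234 junction
`pieceRowsWild_gselStar_two_of_fencedLaws_of_hsides` at (`shiftR`, `omegaR`, `depthOfRecord`, `amplCs`, `amplLevHi`) over the four ★ level laws ∕ H-sides of record
(ED. 8 `dyadicFence_levKappaSignLawAtS2_lo∕hi_ofRecord'`; ED. 9 `hSideLevelsTripleS_lo∕hi_ofRecord hEnd_ofRecord`). -/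
theorem pieceRowsWild_gselStar_two_of_one (h1 : PieceRowsWild gselStar 1) : PieceRowsWild gselStar 2 :=
  F0P3cDyRamTierZeroRowsTwoThreeOfLevels.pieceRowsWild_gselStar_two_of_fencedLaws_of_hsides shiftR omegaR depthOfRecord amplCs amplLevHi
    h1
    F0P3cDyRamLevKappaSignLawsOfRecord.dyadicFence_levKappaSignLawAtS2_lo_ofRecord'
    (F0P3cDyRamHSideStubsOfLevelsCensusLaw.hSideLevelsTripleS_lo_ofRecord F0P3cDyRamHSideStubsOfRecord.hEnd_ofRecord)
    F0P3cDyRamLevKappaSignLawsOfRecord.dyadicFence_levKappaSignLawAtS2_hi_ofRecord'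
    (F0P3cDyRamHSideStubsOfLevelsCensusLaw.hSideLevelsTripleS_hi_ofRecord F0P3cDyRamHSideStubsOfRecord.hEnd_ofRecord)

/-! ## §3  the organ text from the one open row, and from the two open letters -/

set_option maxHeartbeats 800000 in
-- statement-heavy: the organ text is letter-sized
/-- **The organ text of `stub_DyRamCore` from the ONE open row** `h1 : PieceRowsWild gselStar 1` (the rows of `f_{T+}`): rows 0 and 3 are the ★ constants of §1, row 2
is `pieceRowsWild_gselStar_two_of_one h1`, piece props ★ `piecePropsWild_gselStar` (p854876), rank table ★ `rankTableWild_gselStar` (p855060); then — exactly as tier-0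
`DyRamCore_of` — ★ #15 `anchorRowsWild_of_slices` → ★ #6 `rankTransferWild_of_anchorRows` → ★ #14 `dyRamCore_of_rankTransferWild` at `mstarFn`, `gselStar`.  Conclusion =
the organ text of `stub_DyRamCore` (leaf ED. 4 :147–:170) ∕ tier-0 `DyRamCore_of` :357–:378 VERBATIM.
[cite: Rogawski1990, §4.9 Prop. 4.9.1 (a) p. 55] [cite: LanglandsShelstad1989, Theorem (end of §2) p. 484] -/
theorem dyRamCore_of_pieceRowsWild_one (h1 : PieceRowsWild gselStar 1) :
    ∀ (L : Type) [Field L] [NumberField L] [IsCMField L] (μ : HeckeCharacter L)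
      {v : HeightOneSpectrum (𝓞 ↥(maximalRealSubfield L))} (w : UnitaryGroup.PlacesOver L v)
      (_hw : IsCMField.complexConj L • w.1 = w.1) (_he : v.asIdeal.ramificationIdx' w.1.asIdeal ≠ 1)
      (_hμu : μ.IsUnitary)
      (_hμω : ∀ x : ideleGroup ↥(maximalRealSubfield L), μ (AdeleRing.ideleBaseChange ↥(maximalRealSubfield L) L x) = quadraticHeckeCharCM L x)
      (_h2 : ¬ IsUnit (2 : 𝒪[w.1.adicCompletion L]))
      [MeasurableSpace ((UnitaryGroup.cmDatum L 3 (Matrix.of fun i j : Fin 3 => if i.val + j.val + 1 = 3 then (1 : L) else 0)).Local v)] [BorelSpace ((UnitaryGroup.cmDatum L 3 (Matrix.of fun i j : Fin 3 => if i.val + j.val + 1 = 3 then (1 : L) else 0)).Local v)]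
      [∀ γ : ((UnitaryGroup.cmDatum L 3 (Matrix.of fun i j : Fin 3 => if i.val + j.val + 1 = 3 then (1 : L) else 0)).Local v), MeasurableSpace (((UnitaryGroup.cmDatum L 3 (Matrix.of fun i j : Fin 3 => if i.val + j.val + 1 = 3 then (1 : L) else 0)).Local v) ⧸ Subgroup.centralizer ({γ} : Set ((UnitaryGroup.cmDatum L 3 (Matrix.of fun i j : Fin 3 => if i.val + j.val + 1 = 3 then (1 : L) else 0)).Local v)))]
      [∀ γ : ((UnitaryGroup.cmDatum L 3 (Matrix.of fun i j : Fin 3 => if i.val + j.val + 1 = 3 then (1 : L) else 0)).Local v), BorelSpace (((UnitaryGroup.cmDatum L 3 (Matrix.of fun i j : Fin 3 => if i.val + j.val + 1 = 3 then (1 : L) else 0)).Local v) ⧸ Subgroup.centralizer ({γ} : Set ((UnitaryGroup.cmDatum L 3 (Matrix.of fun i j : Fin 3 => if i.val + j.val + 1 = 3 then (1 : L) else 0)).Local v)))]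
      [MeasurableSpace ((UnitaryGroup.cmDatum L 2 (Matrix.of fun i j : Fin 2 => if i.val + j.val + 1 = 2 then (1 : L) else 0)).Local v × (UnitaryGroup.cmDatum L 1 (Matrix.of fun i j : Fin 1 => if i.val + j.val + 1 = 1 then (1 : L) else 0)).Local v)] [BorelSpace ((UnitaryGroup.cmDatum L 2 (Matrix.of fun i j : Fin 2 => if i.val + j.val + 1 = 2 then (1 : L) else 0)).Local v × (UnitaryGroup.cmDatum L 1 (Matrix.of fun i j : Fin 1 => if i.val + j.val + 1 = 1 then (1 : L) else 0)).Local v)]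
      [∀ a : ((UnitaryGroup.cmDatum L 2 (Matrix.of fun i j : Fin 2 => if i.val + j.val + 1 = 2 then (1 : L) else 0)).Local v × (UnitaryGroup.cmDatum L 1 (Matrix.of fun i j : Fin 1 => if i.val + j.val + 1 = 1 then (1 : L) else 0)).Local v), MeasurableSpace (((UnitaryGroup.cmDatum L 2 (Matrix.of fun i j : Fin 2 => if i.val + j.val + 1 = 2 then (1 : L) else 0)).Local v × (UnitaryGroup.cmDatum L 1 (Matrix.of fun i j : Fin 1 => if i.val + j.val + 1 = 1 then (1 : L) else 0)).Local v) ⧸ Subgroup.centralizer ({a} : Set ((UnitaryGroup.cmDatum L 2 (Matrix.of fun i j : Fin 2 => if i.val + j.val + 1 = 2 then (1 : L) else 0)).Local v × (UnitaryGroup.cmDatum L 1 (Matrix.of fun i j : Fin 1 => if i.val + j.val + 1 = 1 then (1 : L) else 0)).Local v)))]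
      [∀ a : ((UnitaryGroup.cmDatum L 2 (Matrix.of fun i j : Fin 2 => if i.val + j.val + 1 = 2 then (1 : L) else 0)).Local v × (UnitaryGroup.cmDatum L 1 (Matrix.of fun i j : Fin 1 => if i.val + j.val + 1 = 1 then (1 : L) else 0)).Local v), BorelSpace (((UnitaryGroup.cmDatum L 2 (Matrix.of fun i j : Fin 2 => if i.val + j.val + 1 = 2 then (1 : L) else 0)).Local v × (UnitaryGroup.cmDatum L 1 (Matrix.of fun i j : Fin 1 => if i.val + j.val + 1 = 1 then (1 : L) else 0)).Local v) ⧸ Subgroup.centralizer ({a} : Set ((UnitaryGroup.cmDatum L 2 (Matrix.of fun i j : Fin 2 => if i.val + j.val + 1 = 2 then (1 : L) else 0)).Local v × (UnitaryGroup.cmDatum L 1 (Matrix.of fun i j : Fin 1 => if i.val + j.val + 1 = 1 then (1 : L) else 0)).Local v)))]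
      (νH : Measure ((UnitaryGroup.cmDatum L 2 (Matrix.of fun i j : Fin 2 => if i.val + j.val + 1 = 2 then (1 : L) else 0)).Local v × (UnitaryGroup.cmDatum L 1 (Matrix.of fun i j : Fin 1 => if i.val + j.val + 1 = 1 then (1 : L) else 0)).Local v)) [νH.IsHaarMeasure] [νH.IsMulRightInvariant]
      (νG₃ : Measure ((UnitaryGroup.cmDatum L 3 (Matrix.of fun i j : Fin 3 => if i.val + j.val + 1 = 3 then (1 : L) else 0)).Local v)) [νG₃.IsHaarMeasure] [νG₃.IsMulRightInvariant]
      {mH : OrbitalMeasureFamily ((UnitaryGroup.cmDatum L 2 (Matrix.of fun i j : Fin 2 => if i.val + j.val + 1 = 2 then (1 : L) else 0)).Local v × (UnitaryGroup.cmDatum L 1 (Matrix.of fun i j : Fin 1 => if i.val + j.val + 1 = 1 then (1 : L) else 0)).Local v)} {mG₃ : OrbitalMeasureFamily ((UnitaryGroup.cmDatum L 3 (Matrix.of fun i j : Fin 3 => if i.val + j.val + 1 = 3 then (1 : L) else 0)).Local v)},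
      mH.IsCanonical (IsLocalGRegular L v) νH → mG₃.IsCanonical (fun γ => IsRegularElt (γ.val : GL (Fin 3) (UnitaryGroup.LocalRing L v))) νG₃ →
      ShalikaGermExpansionNonsplit L (Matrix.of fun i j : Fin 3 => if i.val + j.val + 1 = 3 then (1 : L) else 0) v →
      ∀ (φ₃ : ((UnitaryGroup.cmDatum L 3 (Matrix.of fun i j : Fin 3 => if i.val + j.val + 1 = 3 then (1 : L) else 0)).Local v) → ℂ), IsLocSmooth φ₃ →
        ∃ V ∈ 𝓝 (1 : ((UnitaryGroup.cmDatum L 2 (Matrix.of fun i j : Fin 2 => if i.val + j.val + 1 = 2 then (1 : L) else 0)).Local v × (UnitaryGroup.cmDatum L 1 (Matrix.of fun i j : Fin 1 => if i.val + j.val + 1 = 1 then (1 : L) else 0)).Local v)), ∃ φH : ((UnitaryGroup.cmDatum L 2 (Matrix.of fun i j : Fin 2 => if i.val + j.val + 1 = 2 then (1 : L) else 0)).Local v × (UnitaryGroup.cmDatum L 1 (Matrix.of fun i j : Fin 1 => if i.val + j.val + 1 = 1 then (1 : L) else 0)).Local v) → ℂ, IsLocSmooth φH ∧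
          ∀ γH ∈ V, IsLocalGRegular L v γH →
            stableOrbitalIntegralRel (IsLocalStablyConjH L v) mH φH γH =
              ∑ᶠ c : ConjClasses ((UnitaryGroup.cmDatum L 3 (Matrix.of fun i j : Fin 3 => if i.val + j.val + 1 = 3 then (1 : L) else 0)).Local v), ((finExplicitCollection L (Matrix.of fun i j : Fin 3 => if i.val + j.val + 1 = 3 then (1 : L) else 0) μ (finExplicitDelta_conj_left_all L (Matrix.of fun i j : Fin 3 => if i.val + j.val + 1 = 3 then (1 : L) else 0) μ) (finExplicitDelta_conj_right_all L (Matrix.of fun i j : Fin 3 => if i.val + j.val + 1 = 3 then (1 : L) else 0) μ)) v).Δ γH (Quotient.out c) * classOrbitalIntegral mG₃ φ₃ c :=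
  dyRamCore_of_rankTransferWild mstarFn
    (rankTransferWild_of_anchorRows mstarFn
      (anchorRowsWild_of_slices mstarFn gselStar
        Summit.HodgeConjecture.HodgeConjecture.Cruxes.H413.F0P3cDyRamPiecePropsGselStar.piecePropsWild_gselStar
        Summit.HodgeConjecture.HodgeConjecture.Cruxes.H413.F0P3cDyRamRankTableWildGselStar.rankTableWild_gselStar
        (fun j => by
          fin_cases j
          · exact pieceRowsWild_gselStar_zero_ofRecord
          · exact h1
          · exact pieceRowsWild_gselStar_two_of_one h1
          · exact pieceRowsWild_gselStar_three_ofRecord)))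

set_option maxHeartbeats 800000 in
-- statement-heavy: the organ text and the (β₂) letter are letter-sized
/-- **THE HYPOTHESIS-FORM `Theorems` TWIN OF TIER-0 `DyRamCore_of`** (heir LEAD rules 57 ∕ 69): the organ text of `stub_DyRamCore` VERBATIM (leaf
`F0_P3c_DyadicPaydown.lean` ED. 4 :147–:170; tier-0 :357–:378; type digit of record 4239658620) from EXACTLY the two open STAGE-1b letters — `hβ` = tier-0
`stub_law_cleanSgn` :211–212 VERBATIM, `hβ₂` = tier-0 `stub_law_cleanSgn₂` :231–260 VERBATIM.  `:= dyRamCore_of_pieceRowsWild_one (pieceRowsWild_gselStar_one_of_letters hβ hβ₂)`.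
The CLOSED twin, once (β) and (β₂) are ★ `Theorems` constants, is the two-token application `dyRamCore_of_cleanSgn_of_cleanSgn₂ ‹β› ‹β₂›` (no tier-0 import anywhere).
[cite: Rogawski1990, §4.9 Prop. 4.9.1 (a) p. 55] [cite: LanglandsShelstad1989, Theorem (end of §2) p. 484] -/
theorem dyRamCore_of_cleanSgn_of_cleanSgn₂
    (hβ : ∀ {K : Type} [Field K] [Valued K ℤᵐ⁰] [CompleteSpace K] [Fintype (Valued.ResidueField K)] (σ : K →+* K) (ϖ : K) (d t : ℕ),
    DyadicFence (K := K) (CleanSgnFrameConstLawAt n0DerivedOfRecord mcOfRecord σ ϖ d t))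
    (hβ₂ :
      ∀ (L : Type) [Field L] [NumberField L] [IsCMField L]
        {v : HeightOneSpectrum (𝓞 ↥(maximalRealSubfield L))} (w : UnitaryGroup.PlacesOver L v)
        (hw : IsCMField.complexConj L • w.1 = w.1) (_he : v.asIdeal.ramificationIdx' w.1.asIdeal ≠ 1)
        (_h2 : ¬ IsUnit (2 : Valued.integer (w.1.adicCompletion L)))
        (ϖ : (w.1.adicCompletion L)) (_hϖ : Valued.v ϖ = WithZero.exp (-1 : ℤ)) (d tE : ℕ) (_hD : IsRamifiedQuadraticDatum (galAdicCompletionMap (L := L) (IsCMField.complexConj L) hw) ϖ d tE)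
        [Fintype (Valued.ResidueField (w.1.adicCompletion L))] (δ : (w.1.adicCompletion L)) (_hδ : (galAdicCompletionMap (L := L) (IsCMField.complexConj L) hw) δ = -δ) (_hδ0 : δ ≠ 0)
        (μ : HeckeCharacter L) (_hμu : μ.IsUnitary)
        (_hμω : ∀ x : ideleGroup ↥(maximalRealSubfield L), μ (AdeleRing.ideleBaseChange ↥(maximalRealSubfield L) L x) = quadraticHeckeCharCM L x)
        [MeasurableSpace ((UnitaryGroup.cmDatum L 3 (Matrix.of fun i j : Fin 3 => if i.val + j.val + 1 = 3 then (1 : L) else 0)).Local v)] [BorelSpace ((UnitaryGroup.cmDatum L 3 (Matrix.of fun i j : Fin 3 => if i.val + j.val + 1 = 3 then (1 : L) else 0)).Local v)]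
        [∀ γ : ((UnitaryGroup.cmDatum L 3 (Matrix.of fun i j : Fin 3 => if i.val + j.val + 1 = 3 then (1 : L) else 0)).Local v), MeasurableSpace (((UnitaryGroup.cmDatum L 3 (Matrix.of fun i j : Fin 3 => if i.val + j.val + 1 = 3 then (1 : L) else 0)).Local v) ⧸ Subgroup.centralizer ({γ} : Set ((UnitaryGroup.cmDatum L 3 (Matrix.of fun i j : Fin 3 => if i.val + j.val + 1 = 3 then (1 : L) else 0)).Local v)))]
        [∀ γ : ((UnitaryGroup.cmDatum L 3 (Matrix.of fun i j : Fin 3 => if i.val + j.val + 1 = 3 then (1 : L) else 0)).Local v), BorelSpace (((UnitaryGroup.cmDatum L 3 (Matrix.of fun i j : Fin 3 => if i.val + j.val + 1 = 3 then (1 : L) else 0)).Local v) ⧸ Subgroup.centralizer ({γ} : Set ((UnitaryGroup.cmDatum L 3 (Matrix.of fun i j : Fin 3 => if i.val + j.val + 1 = 3 then (1 : L) else 0)).Local v)))]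
        [MeasurableSpace ((UnitaryGroup.cmDatum L 2 (Matrix.of fun i j : Fin 2 => if i.val + j.val + 1 = 2 then (1 : L) else 0)).Local v × (UnitaryGroup.cmDatum L 1 (Matrix.of fun i j : Fin 1 => if i.val + j.val + 1 = 1 then (1 : L) else 0)).Local v)] [BorelSpace ((UnitaryGroup.cmDatum L 2 (Matrix.of fun i j : Fin 2 => if i.val + j.val + 1 = 2 then (1 : L) else 0)).Local v × (UnitaryGroup.cmDatum L 1 (Matrix.of fun i j : Fin 1 => if i.val + j.val + 1 = 1 then (1 : L) else 0)).Local v)]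
        [∀ a : ((UnitaryGroup.cmDatum L 2 (Matrix.of fun i j : Fin 2 => if i.val + j.val + 1 = 2 then (1 : L) else 0)).Local v × (UnitaryGroup.cmDatum L 1 (Matrix.of fun i j : Fin 1 => if i.val + j.val + 1 = 1 then (1 : L) else 0)).Local v), MeasurableSpace (((UnitaryGroup.cmDatum L 2 (Matrix.of fun i j : Fin 2 => if i.val + j.val + 1 = 2 then (1 : L) else 0)).Local v × (UnitaryGroup.cmDatum L 1 (Matrix.of fun i j : Fin 1 => if i.val + j.val + 1 = 1 then (1 : L) else 0)).Local v) ⧸ Subgroup.centralizer ({a} : Set ((UnitaryGroup.cmDatum L 2 (Matrix.of fun i j : Fin 2 => if i.val + j.val + 1 = 2 then (1 : L) else 0)).Local v × (UnitaryGroup.cmDatum L 1 (Matrix.of fun i j : Fin 1 => if i.val + j.val + 1 = 1 then (1 : L) else 0)).Local v)))]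
        [∀ a : ((UnitaryGroup.cmDatum L 2 (Matrix.of fun i j : Fin 2 => if i.val + j.val + 1 = 2 then (1 : L) else 0)).Local v × (UnitaryGroup.cmDatum L 1 (Matrix.of fun i j : Fin 1 => if i.val + j.val + 1 = 1 then (1 : L) else 0)).Local v), BorelSpace (((UnitaryGroup.cmDatum L 2 (Matrix.of fun i j : Fin 2 => if i.val + j.val + 1 = 2 then (1 : L) else 0)).Local v × (UnitaryGroup.cmDatum L 1 (Matrix.of fun i j : Fin 1 => if i.val + j.val + 1 = 1 then (1 : L) else 0)).Local v) ⧸ Subgroup.centralizer ({a} : Set ((UnitaryGroup.cmDatum L 2 (Matrix.of fun i j : Fin 2 => if i.val + j.val + 1 = 2 then (1 : L) else 0)).Local v × (UnitaryGroup.cmDatum L 1 (Matrix.of fun i j : Fin 1 => if i.val + j.val + 1 = 1 then (1 : L) else 0)).Local v)))]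
        (νH : Measure ((UnitaryGroup.cmDatum L 2 (Matrix.of fun i j : Fin 2 => if i.val + j.val + 1 = 2 then (1 : L) else 0)).Local v × (UnitaryGroup.cmDatum L 1 (Matrix.of fun i j : Fin 1 => if i.val + j.val + 1 = 1 then (1 : L) else 0)).Local v)) [νH.IsHaarMeasure] [νH.IsMulRightInvariant]
        (νG₃ : Measure ((UnitaryGroup.cmDatum L 3 (Matrix.of fun i j : Fin 3 => if i.val + j.val + 1 = 3 then (1 : L) else 0)).Local v)) [νG₃.IsHaarMeasure] [νG₃.IsMulRightInvariant]
        (mH : OrbitalMeasureFamily ((UnitaryGroup.cmDatum L 2 (Matrix.of fun i j : Fin 2 => if i.val + j.val + 1 = 2 then (1 : L) else 0)).Local v × (UnitaryGroup.cmDatum L 1 (Matrix.of fun i j : Fin 1 => if i.val + j.val + 1 = 1 then (1 : L) else 0)).Local v)) (mG₃ : OrbitalMeasureFamily ((UnitaryGroup.cmDatum L 3 (Matrix.of fun i j : Fin 3 => if i.val + j.val + 1 = 3 then (1 : L) else 0)).Local v))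
        (_hmH : mH.IsCanonical (IsLocalGRegular L v) νH) (_hmG : mG₃.IsCanonical (fun γ => IsRegularElt (γ.val : GL (Fin 3) (UnitaryGroup.LocalRing L v))) νG₃),
                  (∃ V ∈ 𝓝 (1 : ((UnitaryGroup.cmDatum L 2 (Matrix.of fun i j : Fin 2 => if i.val + j.val + 1 = 2 then (1 : L) else 0)).Local v × (UnitaryGroup.cmDatum L 1 (Matrix.of fun i j : Fin 1 => if i.val + j.val + 1 = 1 then (1 : L) else 0)).Local v)), ∀ γH ∈ V, IsLocalGRegular L v γH →
      ¬ (∃ x : (w.1.adicCompletion L), (((((γH).1.val : GL (Fin 2) (UnitaryGroup.LocalRing L v)).val.map (Pi.evalRingHom (fun w' : UnitaryGroup.PlacesOver L v => w'.1.adicCompletion L) w))).charpoly).IsRoot x) →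
      ∀ δp δm : ((UnitaryGroup.cmDatum L 3 (Matrix.of fun i j : Fin 3 => if i.val + j.val + 1 = 3 then (1 : L) else 0)).Local v), IsLocalNormPair L (Matrix.of fun i j : Fin 3 => if i.val + j.val + 1 = 3 then (1 : L) else 0) v γH δp → finKappaAt L v (Matrix.of fun i j : Fin 3 => if i.val + j.val + 1 = 3 then (1 : L) else 0) γH δp = 1 → IsLocalNormPair L (Matrix.of fun i j : Fin 3 => if i.val + j.val + 1 = 3 then (1 : L) else 0) v γH δm → finKappaAt L v (Matrix.of fun i j : Fin 3 => if i.val + j.val + 1 = 3 then (1 : L) else 0) γH δm = -1 →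
        (transvPlusFixCount (galAdicCompletionMap (L := L) (IsCMField.complexConj L) hw) ϖ d (d % 2) (mstarOfRecord d) ((localNonsplitEquiv (IsCMField.complexConj L) (Matrix.of fun i j : Fin 3 => if i.val + j.val + 1 = 3 then (1 : L) else 0) (IsCMField.complexConj_ne_one L) w hw δp :
              ↥(unitaryGroupOfForm (galAdicCompletionMap (L := L) (IsCMField.complexConj L) hw) (placeForm (Matrix.of fun i j : Fin 3 => if i.val + j.val + 1 = 3 then (1 : L) else 0) w.1))) : GL (Fin 3) (w.1.adicCompletion L)) : ℤ) -
            (cleanMinusFixCount (galAdicCompletionMap (L := L) (IsCMField.complexConj L) hw) ϖ d (d % 2) (mstarOfRecord d) (mcOfRecord d) ((localNonsplitEquiv (IsCMField.complexConj L) (Matrix.of fun i j : Fin 3 => if i.val + j.val + 1 = 3 then (1 : L) else 0) (IsCMField.complexConj_ne_one L) w hw δp :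
              ↥(unitaryGroupOfForm (galAdicCompletionMap (L := L) (IsCMField.complexConj L) hw) (placeForm (Matrix.of fun i j : Fin 3 => if i.val + j.val + 1 = 3 then (1 : L) else 0) w.1))) : GL (Fin 3) (w.1.adicCompletion L)) : ℤ) =
          (transvPlusFixCount (galAdicCompletionMap (L := L) (IsCMField.complexConj L) hw) ϖ d (d % 2) (mstarOfRecord d) ((localNonsplitEquiv (IsCMField.complexConj L) (Matrix.of fun i j : Fin 3 => if i.val + j.val + 1 = 3 then (1 : L) else 0) (IsCMField.complexConj_ne_one L) w hw δm :
              ↥(unitaryGroupOfForm (galAdicCompletionMap (L := L) (IsCMField.complexConj L) hw) (placeForm (Matrix.of fun i j : Fin 3 => if i.val + j.val + 1 = 3 then (1 : L) else 0) w.1))) : GL (Fin 3) (w.1.adicCompletion L)) : ℤ) -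
            (cleanMinusFixCount (galAdicCompletionMap (L := L) (IsCMField.complexConj L) hw) ϖ d (d % 2) (mstarOfRecord d) (mcOfRecord d) ((localNonsplitEquiv (IsCMField.complexConj L) (Matrix.of fun i j : Fin 3 => if i.val + j.val + 1 = 3 then (1 : L) else 0) (IsCMField.complexConj_ne_one L) w hw δm :
              ↥(unitaryGroupOfForm (galAdicCompletionMap (L := L) (IsCMField.complexConj L) hw) (placeForm (Matrix.of fun i j : Fin 3 => if i.val + j.val + 1 = 3 then (1 : L) else 0) w.1))) : GL (Fin 3) (w.1.adicCompletion L)) : ℤ))) :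
    ∀ (L : Type) [Field L] [NumberField L] [IsCMField L] (μ : HeckeCharacter L)
      {v : HeightOneSpectrum (𝓞 ↥(maximalRealSubfield L))} (w : UnitaryGroup.PlacesOver L v)
      (_hw : IsCMField.complexConj L • w.1 = w.1) (_he : v.asIdeal.ramificationIdx' w.1.asIdeal ≠ 1)
      (_hμu : μ.IsUnitary)
      (_hμω : ∀ x : ideleGroup ↥(maximalRealSubfield L), μ (AdeleRing.ideleBaseChange ↥(maximalRealSubfield L) L x) = quadraticHeckeCharCM L x)
      (_h2 : ¬ IsUnit (2 : 𝒪[w.1.adicCompletion L]))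
      [MeasurableSpace ((UnitaryGroup.cmDatum L 3 (Matrix.of fun i j : Fin 3 => if i.val + j.val + 1 = 3 then (1 : L) else 0)).Local v)] [BorelSpace ((UnitaryGroup.cmDatum L 3 (Matrix.of fun i j : Fin 3 => if i.val + j.val + 1 = 3 then (1 : L) else 0)).Local v)]
      [∀ γ : ((UnitaryGroup.cmDatum L 3 (Matrix.of fun i j : Fin 3 => if i.val + j.val + 1 = 3 then (1 : L) else 0)).Local v), MeasurableSpace (((UnitaryGroup.cmDatum L 3 (Matrix.of fun i j : Fin 3 => if i.val + j.val + 1 = 3 then (1 : L) else 0)).Local v) ⧸ Subgroup.centralizer ({γ} : Set ((UnitaryGroup.cmDatum L 3 (Matrix.of fun i j : Fin 3 => if i.val + j.val + 1 = 3 then (1 : L) else 0)).Local v)))]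
      [∀ γ : ((UnitaryGroup.cmDatum L 3 (Matrix.of fun i j : Fin 3 => if i.val + j.val + 1 = 3 then (1 : L) else 0)).Local v), BorelSpace (((UnitaryGroup.cmDatum L 3 (Matrix.of fun i j : Fin 3 => if i.val + j.val + 1 = 3 then (1 : L) else 0)).Local v) ⧸ Subgroup.centralizer ({γ} : Set ((UnitaryGroup.cmDatum L 3 (Matrix.of fun i j : Fin 3 => if i.val + j.val + 1 = 3 then (1 : L) else 0)).Local v)))]
      [MeasurableSpace ((UnitaryGroup.cmDatum L 2 (Matrix.of fun i j : Fin 2 => if i.val + j.val + 1 = 2 then (1 : L) else 0)).Local v × (UnitaryGroup.cmDatum L 1 (Matrix.of fun i j : Fin 1 => if i.val + j.val + 1 = 1 then (1 : L) else 0)).Local v)] [BorelSpace ((UnitaryGroup.cmDatum L 2 (Matrix.of fun i j : Fin 2 => if i.val + j.val + 1 = 2 then (1 : L) else 0)).Local v × (UnitaryGroup.cmDatum L 1 (Matrix.of fun i j : Fin 1 => if i.val + j.val + 1 = 1 then (1 : L) else 0)).Local v)]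
      [∀ a : ((UnitaryGroup.cmDatum L 2 (Matrix.of fun i j : Fin 2 => if i.val + j.val + 1 = 2 then (1 : L) else 0)).Local v × (UnitaryGroup.cmDatum L 1 (Matrix.of fun i j : Fin 1 => if i.val + j.val + 1 = 1 then (1 : L) else 0)).Local v), MeasurableSpace (((UnitaryGroup.cmDatum L 2 (Matrix.of fun i j : Fin 2 => if i.val + j.val + 1 = 2 then (1 : L) else 0)).Local v × (UnitaryGroup.cmDatum L 1 (Matrix.of fun i j : Fin 1 => if i.val + j.val + 1 = 1 then (1 : L) else 0)).Local v) ⧸ Subgroup.centralizer ({a} : Set ((UnitaryGroup.cmDatum L 2 (Matrix.of fun i j : Fin 2 => if i.val + j.val + 1 = 2 then (1 : L) else 0)).Local v × (UnitaryGroup.cmDatum L 1 (Matrix.of fun i j : Fin 1 => if i.val + j.val + 1 = 1 then (1 : L) else 0)).Local v)))]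
      [∀ a : ((UnitaryGroup.cmDatum L 2 (Matrix.of fun i j : Fin 2 => if i.val + j.val + 1 = 2 then (1 : L) else 0)).Local v × (UnitaryGroup.cmDatum L 1 (Matrix.of fun i j : Fin 1 => if i.val + j.val + 1 = 1 then (1 : L) else 0)).Local v), BorelSpace (((UnitaryGroup.cmDatum L 2 (Matrix.of fun i j : Fin 2 => if i.val + j.val + 1 = 2 then (1 : L) else 0)).Local v × (UnitaryGroup.cmDatum L 1 (Matrix.of fun i j : Fin 1 => if i.val + j.val + 1 = 1 then (1 : L) else 0)).Local v) ⧸ Subgroup.centralizer ({a} : Set ((UnitaryGroup.cmDatum L 2 (Matrix.of fun i j : Fin 2 => if i.val + j.val + 1 = 2 then (1 : L) else 0)).Local v × (UnitaryGroup.cmDatum L 1 (Matrix.of fun i j : Fin 1 => if i.val + j.val + 1 = 1 then (1 : L) else 0)).Local v)))]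
      (νH : Measure ((UnitaryGroup.cmDatum L 2 (Matrix.of fun i j : Fin 2 => if i.val + j.val + 1 = 2 then (1 : L) else 0)).Local v × (UnitaryGroup.cmDatum L 1 (Matrix.of fun i j : Fin 1 => if i.val + j.val + 1 = 1 then (1 : L) else 0)).Local v)) [νH.IsHaarMeasure] [νH.IsMulRightInvariant]
      (νG₃ : Measure ((UnitaryGroup.cmDatum L 3 (Matrix.of fun i j : Fin 3 => if i.val + j.val + 1 = 3 then (1 : L) else 0)).Local v)) [νG₃.IsHaarMeasure] [νG₃.IsMulRightInvariant]
      {mH : OrbitalMeasureFamily ((UnitaryGroup.cmDatum L 2 (Matrix.of fun i j : Fin 2 => if i.val + j.val + 1 = 2 then (1 : L) else 0)).Local v × (UnitaryGroup.cmDatum L 1 (Matrix.of fun i j : Fin 1 => if i.val + j.val + 1 = 1 then (1 : L) else 0)).Local v)} {mG₃ : OrbitalMeasureFamily ((UnitaryGroup.cmDatum L 3 (Matrix.of fun i j : Fin 3 => if i.val + j.val + 1 = 3 then (1 : L) else 0)).Local v)},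
      mH.IsCanonical (IsLocalGRegular L v) νH → mG₃.IsCanonical (fun γ => IsRegularElt (γ.val : GL (Fin 3) (UnitaryGroup.LocalRing L v))) νG₃ →
      ShalikaGermExpansionNonsplit L (Matrix.of fun i j : Fin 3 => if i.val + j.val + 1 = 3 then (1 : L) else 0) v →
      ∀ (φ₃ : ((UnitaryGroup.cmDatum L 3 (Matrix.of fun i j : Fin 3 => if i.val + j.val + 1 = 3 then (1 : L) else 0)).Local v) → ℂ), IsLocSmooth φ₃ →
        ∃ V ∈ 𝓝 (1 : ((UnitaryGroup.cmDatum L 2 (Matrix.of fun i j : Fin 2 => if i.val + j.val + 1 = 2 then (1 : L) else 0)).Local v × (UnitaryGroup.cmDatum L 1 (Matrix.of fun i j : Fin 1 => if i.val + j.val + 1 = 1 then (1 : L) else 0)).Local v)), ∃ φH : ((UnitaryGroup.cmDatum L 2 (Matrix.of fun i j : Fin 2 => if i.val + j.val + 1 = 2 then (1 : L) else 0)).Local v × (UnitaryGroup.cmDatum L 1 (Matrix.of fun i j : Fin 1 => if i.val + j.val + 1 = 1 then (1 : L) else 0)).Local v) → ℂ, IsLocSmooth φH ∧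
          ∀ γH ∈ V, IsLocalGRegular L v γH →
            stableOrbitalIntegralRel (IsLocalStablyConjH L v) mH φH γH =
              ∑ᶠ c : ConjClasses ((UnitaryGroup.cmDatum L 3 (Matrix.of fun i j : Fin 3 => if i.val + j.val + 1 = 3 then (1 : L) else 0)).Local v), ((finExplicitCollection L (Matrix.of fun i j : Fin 3 => if i.val + j.val + 1 = 3 then (1 : L) else 0) μ (finExplicitDelta_conj_left_all L (Matrix.of fun i j : Fin 3 => if i.val + j.val + 1 = 3 then (1 : L) else 0) μ) (finExplicitDelta_conj_right_all L (Matrix.of fun i j : Fin 3 => if i.val + j.val + 1 = 3 then (1 : L) else 0) μ)) v).Δ γH (Quotient.out c) * classOrbitalIntegral mG₃ φ₃ c :=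
  dyRamCore_of_pieceRowsWild_one (pieceRowsWild_gselStar_one_of_letters hβ hβ₂)

end Summit.HodgeConjecture.HodgeConjecture.Cruxes.H413.F0P3cDyRamCoreOfLetters

end
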